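import Literature.Probability.RandomPlanarGeometry.HexSAWStripBridgeContactDensityPointwise
import Literature.Probability.RandomPlanarGeometry.HexSAWStripWidthTwoKernel
import Mathlib.Analysis.Normed.Group.Tannery
import HarnessLib

/-!
# The surface-contact density of long critical β-WALKS of the honeycomb strip equals the bridge density `θ_T`: heads and tails carry only
# `o(n)` contacts (module «BETA-CONTACT-DENSITY»)

Topic `Literature/Probability/RandomPlanarGeometry` (continues «BETA-LENGTH-SPLIT» / «BETA-LENGTH-LAW» (`HV.betaLenSum_eq_two_mul`: the exact split
`bℓ = 2(nℓ + Σ fℓ·dℓ·gℓ)` for every `y ≥ 0`; `HV.headLen/hb0Len/tailLen`, `HV.summable_headLen/tailLen`, `HV.exists_hb0Len_stripYT_le`, `HV.tendsto_noRenLen_atTop`,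
`HV.tendsto_betaRenewalLen_even`, `HV.exists_pos_tendsto_betaLenSum_even`, `HV.even_of_headLen_ne_zero`…), «CONTACT-DENSITY(-POINTWISE)» #659/#687
(`HV.mul_derivSum_eq_contactSum`, `HV.hat_contactSlices_eq/facts`, ★ `HV.tendsto_contacts_per_step_pointwise`: the BRIDGE contact density `θ_T`), «AMPLITUDE-RATIO»
#633 (`HV.bridge_amplitudes_explicit`, `HV.tendsto_stripLenD_residue_explicit`), «WIDTH-TWO-KERNEL» #715 (closed-form Perron data)).  Lane «pcv-sawmu»
(CriticalPhenomena venture), a-p2 g24 — HANDOFF-gen23 item 1 («β-WALK contact density (heads/tails)»), whose worry «is the #top-weighted head mass finite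
at y_T?» turns out to be unnecessary: a head with `i` vertices has at most `i` contacts and `Σ_{i ≤ n} (i/n)·fℓ(i) → 0` by dominated convergence.  Sources of
the SETTING: N. R. Beaton et al., CMP 326 (2014) §3.2 (`B_T(x; y) = Σ x^{|ω|}y^{#contacts}`), Corollary 8 (`y_T`); H. Duminil-Copin, A. Hammond, CMP 324 (2013)
§2.2; W. Feller I (1968) XIII.3 (periodic renewal sequences; renewal with a delay), XIII.6.  Nothing of the kind is printed for the strip.

## What is proved (namespace `Literature.Probability.RandomPlanarGeometry.SAW.HV`; `y_T = stripYT T`; `cβ_T(n)(y) := Σ_{β-walks, n vertices} #top·x_c^n y^{#top}`)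

* §1 the contact-weighted pieces `betaCon`, `noRenCon`, `headCon`, `hb0Con`, `tailCon`; §2 `hasDerivAt_sum_vertexWeight`, `mul_derivVertexSum_eq`,
  `hasDerivAt_sum_wD` (derivatives of the monomial sums).
* §3 ★★ `betaCon_eq_two_mul` — for `y > 0`: `cβ(n) = 2(cnℓ(n) + Σ_{a,b}Σ_{i+j+k=n}(cfℓ·dℓ·gℓ + fℓ·cdℓ·gℓ + fℓ·dℓ·cgℓ))` (`y∂_y` of the exact split).
* §4 `con_le` (`cfℓ(i) ≤ i·fℓ(i)`, …), `hb0Con_eq_sum_LUset`; §5 ★ `tendsto_endContactTerms_div` (head and tail contact terms are `o(m)`: Tannery with zero limit),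
  ★ `tendsto_midContactTerm_even` (pointwise: parity bookkeeping + #687 + #633), ★★ `tendsto_midContactSum_div` (Tannery).
* §6 ★★★★ `tendsto_beta_contacts_per_step` — **`cβ_T(2m)/(2m·bℓ_T(2m)) → θ_T = ⟨ℓ, C̄_M u⟩/⟨ℓ, M̄_len u⟩`** for every `T ≥ 2` and ANY positive fixed vectors
  `u, ℓ` of `Iinf T y_T`: the mean number of surface contacts per step of a critical β-walk with `2m` vertices tends to the bridge density;
  ★★★ `widthTwo_beta_contacts_per_step` — `T = 2`: `→ (3 − √2)/4`.

Label: LANE THEOREM (own result of lane «pcv-sawmu», a-p2 g24, 2026-08-27).  NOT claimed: concentration for β-walks (their second moment needs the bridge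
`hC2` of «CONTACT-LLN»), the odd lengths (no β-walk has an odd number of vertices), `T = 1`, rates.
-/

noncomputable section

namespace Literature.Probability.RandomPlanarGeometry.SAW

open Finset Filter Topology Matrix BigOperators
open Literature.Analysis.Matrix Literature.Probability.Process Literature.Probability.LatticeModels Literature.Probability.Percolation

namespace HV

variable {T : ℕ}

/-! ### §1 The contact-weighted pieces of the length split -/

/-- `cβ_T(n)(y) := Σ_{β-walks of S_T with n vertices} #top · x_c^{n} y^{#top}` — the contact-weighted β-slice (`= y ∂_y bℓ_T(n)(y)`).
[cite: BeatonBousquetMelouDeGierDuminilCopinGuttmann2014, §3.2 (B_T(x; y), contacts with the top wall); lane «pcv-sawmu» a-p2 g24] -/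
def betaCon (T n : ℕ) (y : ℝ) : ℝ := ∑ l ∈ betaLen T n n, (topCnt T l : ℝ) * (hexCriticalFugacity ^ l.length * y ^ topCnt T l)

/-- The contact-weighted no-renewal slice `Σ #top · x_c^{|ω|} y^{#top}` over the case-A β-walks with `n` vertices and no renewal index.
[cite: DuminilCopinHammond2013, §2.2; lane «pcv-sawmu» a-p2 g24] -/
def noRenCon (T n : ℕ) (y : ℝ) : ℝ :=
  ∑ l ∈ (noRenA T n).filter (fun l => l.length = n), (topCnt T l : ℝ) * (hexCriticalFugacity ^ l.length * y ^ topCnt T l)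

/-- The contact-weighted head slice `cfℓ_c(i)(y) = Σ_{heads with i vertices} #top · x_c^{i} y^{#top}`. [cite: DuminilCopinHammond2013, §2.2; lane «pcv-sawmu» a-p2 g24] -/
def headCon (T i : ℕ) (c : ℤ) (y : ℝ) : ℝ :=
  ∑ h ∈ (headN T i c).filter (fun h => h.length = i), (topCnt T h : ℝ) * (hexCriticalFugacity ^ h.length * y ^ topCnt T h)

/-- The contact-weighted middle slice `cdℓ_{ce}(j)(y) = Σ_{bridges with j steps} #top(tail) · wD`. [cite: DuminilCopinHammond2013, §2.2; lane «pcv-sawmu» a-p2 g24] -/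
def hb0Con (T j : ℕ) (c e : ℤ) (y : ℝ) : ℝ :=
  ∑ b ∈ (HB0 T j c e).filter (fun b => b.length = j + 1), (topCnt T b.tail : ℝ) * wD T y b

/-- The contact-weighted tail slice `cgℓ_e(k)(y) = Σ_{tails with k steps} #top(tail) · wD`. [cite: DuminilCopinHammond2013, §2.2; lane «pcv-sawmu» a-p2 g24] -/
def tailCon (T k : ℕ) (e : ℤ) (y : ℝ) : ℝ :=
  ∑ g ∈ (tailN T k e).filter (fun g => g.length = k + 1), (topCnt T g.tail : ℝ) * wD T y g

/-! ### §2 Derivatives of the monomial sums: `y ∂_y Σ x^{|l|} y^{#top} = Σ #top · x^{|l|} y^{#top}` -/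

section Deriv

/-- `k · y^{k−1} · y = k · y^k` (plumbing; private twins exist in the tree). [cite: Feller1968, XIII.3; lane plumbing a-p2 g24] -/
private theorem natMul_pow_pred_mul'' (k : ℕ) (y : ℝ) : (k : ℝ) * y ^ (k - 1) * y = (k : ℝ) * y ^ k := by
  rcases k with _ | k
  · simp
  · rw [Nat.add_sub_cancel, mul_assoc, ← pow_succ]

/-- Derivative of a vertex-weighted sum `Σ_{l ∈ S} x_c^{|l|} y^{#top(l)}` (plumbing). [cite: BeatonBousquetMelouDeGierDuminilCopinGuttmann2014, §3.2; lane plumbing a-p2 g24] -/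
theorem hasDerivAt_sum_vertexWeight (S : Finset (List HV)) (y : ℝ) :
    HasDerivAt (fun y => ∑ l ∈ S, hexCriticalFugacity ^ l.length * y ^ topCnt T l)
      (∑ l ∈ S, hexCriticalFugacity ^ l.length * ((topCnt T l : ℝ) * y ^ (topCnt T l - 1))) y :=
  HasDerivAt.fun_sum fun _ _ => (hasDerivAt_pow _ y).const_mul _

/-- `y · ∂_y Σ x_c^{|l|} y^{#top} = Σ #top · x_c^{|l|} y^{#top}` (plumbing). [cite: BeatonBousquetMelouDeGierDuminilCopinGuttmann2014, §3.2; lane plumbing a-p2 g24] -/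
theorem mul_derivVertexSum_eq (S : Finset (List HV)) (y : ℝ) :
    y * ∑ l ∈ S, hexCriticalFugacity ^ l.length * ((topCnt T l : ℝ) * y ^ (topCnt T l - 1)) =
      ∑ l ∈ S, (topCnt T l : ℝ) * (hexCriticalFugacity ^ l.length * y ^ topCnt T l) := by
  rw [mul_sum]
  refine sum_congr rfl fun l _ => ?_
  calc y * (hexCriticalFugacity ^ l.length * ((topCnt T l : ℝ) * y ^ (topCnt T l - 1)))
      = hexCriticalFugacity ^ l.length * ((topCnt T l : ℝ) * y ^ (topCnt T l - 1) * y) := by ring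
    _ = _ := by rw [natMul_pow_pred_mul'']; ring

/-- Derivative of an edge-weighted sum `Σ_{l ∈ S} wD T y l` (plumbing; the tree's `hasDerivAt_LUs` for an arbitrary finset). [cite: DuminilCopinHammond2013, §2.2; lane plumbing a-p2 g24] -/
theorem hasDerivAt_sum_wD (S : Finset (List HV)) (y : ℝ) :
    HasDerivAt (fun y => ∑ l ∈ S, wD T y l)
      (∑ l ∈ S, hexCriticalFugacity ^ (l.length - 1) * ((topCnt T l.tail : ℝ) * y ^ (topCnt T l.tail - 1))) y := by
  unfold wD
  exact HasDerivAt.fun_sum fun _ _ => (hasDerivAt_pow _ y).const_mul _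

end Deriv

/-! ### §3 The derived length split: contacts of a β-walk = contacts of its head + middle bridge + tail -/

section Split

/-- ★★ **THE CONTACT-WEIGHTED LENGTH SPLIT OF THE β-WALKS** (`T ≥ 1`, `y > 0`): applying `y ∂_y` to the exact split `bℓ = 2(nℓ + Σ fℓ·dℓ·gℓ)`
of «BETA-LENGTH-SPLIT» (an identity of polynomials in `y` on `[0, ∞)`),
`cβ_T(n) = 2·( cnℓ_T(n) + Σ_{a,b} Σ_{i+j+k=n} ( cfℓ_a(i) dℓ_{ab}(j) gℓ_b(k) + fℓ_a(i) cdℓ_{ab}(j) gℓ_b(k) + fℓ_a(i) dℓ_{ab}(j) cgℓ_b(k) ) )` —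
the surface contacts of a β-walk are those of its head, its middle bridge and its tail. [cite: DuminilCopinHammond2013, §2.2 (unique decomposition at renewal points); BeatonBousquetMelouDeGierDuminilCopinGuttmann2014, §3.2; lane «pcv-sawmu» a-p2 g24 — own] -/
theorem betaCon_eq_two_mul (hT : 1 ≤ T) {y : ℝ} (hy : 0 < y) (n : ℕ) :
    betaCon T n y = 2 * (noRenCon T n y + ∑ a : Fin (2 * T), ∑ b : Fin (2 * T), ∑ t ∈ T3 n,
      (headCon T t.1 (a : ℕ) y * hb0Len T t.2.1 (a : ℕ) (b : ℕ) y * tailLen T t.2.2 (b : ℕ) y +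
        headLen T t.1 (a : ℕ) y * hb0Con T t.2.1 (a : ℕ) (b : ℕ) y * tailLen T t.2.2 (b : ℕ) y +
        headLen T t.1 (a : ℕ) y * hb0Len T t.2.1 (a : ℕ) (b : ℕ) y * tailCon T t.2.2 (b : ℕ) y)) := by
  -- derivative sums
  set dB : ℝ → ℝ := fun y => ∑ l ∈ betaLen T n n, hexCriticalFugacity ^ l.length * ((topCnt T l : ℝ) * y ^ (topCnt T l - 1)) with hdB
  set dN : ℝ → ℝ := fun y => ∑ l ∈ (noRenA T n).filter (fun l => l.length = n),
    hexCriticalFugacity ^ l.length * ((topCnt T l : ℝ) * y ^ (topCnt T l - 1)) with hdN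
  set dF : ℕ → ℤ → ℝ → ℝ := fun i c y => ∑ h ∈ (headN T i c).filter (fun h => h.length = i),
    hexCriticalFugacity ^ h.length * ((topCnt T h : ℝ) * y ^ (topCnt T h - 1)) with hdF
  set dD : ℕ → ℤ → ℤ → ℝ → ℝ := fun j c e y => ∑ b ∈ (HB0 T j c e).filter (fun b => b.length = j + 1),
    hexCriticalFugacity ^ (b.length - 1) * ((topCnt T b.tail : ℝ) * y ^ (topCnt T b.tail - 1)) with hdD
  set dG : ℕ → ℤ → ℝ → ℝ := fun k e y => ∑ g ∈ (tailN T k e).filter (fun g => g.length = k + 1),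
    hexCriticalFugacity ^ (g.length - 1) * ((topCnt T g.tail : ℝ) * y ^ (topCnt T g.tail - 1)) with hdG
  have hF_deriv : ∀ i (c : ℤ), HasDerivAt (fun y => headLen T i c y) (dF i c y) y := fun i c => by
    unfold headLen headLenN
    exact hasDerivAt_sum_vertexWeight _ y
  have hD_deriv : ∀ j (c e : ℤ), HasDerivAt (fun y => hb0Len T j c e y) (dD j c e y) y := fun j c e => by
    unfold hb0Len hb0LenN
    exact hasDerivAt_sum_wD _ y
  have hG_deriv : ∀ k (e : ℤ), HasDerivAt (fun y => tailLen T k e y) (dG k e y) y := fun k e => by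
    unfold tailLen tailLenN
    exact hasDerivAt_sum_wD _ y
  have hLHS : HasDerivAt (fun y => betaLenSum T n y) (dB y) y := by
    unfold betaLenSum
    exact hasDerivAt_sum_vertexWeight _ y
  have hterm : ∀ (a b : Fin (2 * T)) (t : ℕ × ℕ × ℕ),
      HasDerivAt (fun y => headLen T t.1 (a : ℕ) y * hb0Len T t.2.1 (a : ℕ) (b : ℕ) y * tailLen T t.2.2 (b : ℕ) y)
        ((dF t.1 (a : ℕ) y * hb0Len T t.2.1 (a : ℕ) (b : ℕ) y + headLen T t.1 (a : ℕ) y * dD t.2.1 (a : ℕ) (b : ℕ) y) *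
            tailLen T t.2.2 (b : ℕ) y +
          headLen T t.1 (a : ℕ) y * hb0Len T t.2.1 (a : ℕ) (b : ℕ) y * dG t.2.2 (b : ℕ) y) y := fun a b t =>
    ((hF_deriv t.1 (a : ℕ)).mul (hD_deriv t.2.1 (a : ℕ) (b : ℕ))).mul (hG_deriv t.2.2 (b : ℕ))
  have hsum3 : HasDerivAt (fun y => ∑ a : Fin (2 * T), ∑ b : Fin (2 * T), ∑ t ∈ T3 n,
      headLen T t.1 (a : ℕ) y * hb0Len T t.2.1 (a : ℕ) (b : ℕ) y * tailLen T t.2.2 (b : ℕ) y)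
      (∑ a : Fin (2 * T), ∑ b : Fin (2 * T), ∑ t ∈ T3 n,
        ((dF t.1 (a : ℕ) y * hb0Len T t.2.1 (a : ℕ) (b : ℕ) y + headLen T t.1 (a : ℕ) y * dD t.2.1 (a : ℕ) (b : ℕ) y) *
            tailLen T t.2.2 (b : ℕ) y +
          headLen T t.1 (a : ℕ) y * hb0Len T t.2.1 (a : ℕ) (b : ℕ) y * dG t.2.2 (b : ℕ) y)) y :=
    HasDerivAt.fun_sum fun a _ => HasDerivAt.fun_sum fun b _ => HasDerivAt.fun_sum fun t _ => hterm a b t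
  have hN_deriv : HasDerivAt (fun y => noRenLen T n y) (dN y) y := by
    unfold noRenLen
    exact hasDerivAt_sum_vertexWeight _ y
  have hRHS : HasDerivAt (fun y => 2 * (noRenLen T n y + ∑ a : Fin (2 * T), ∑ b : Fin (2 * T), ∑ t ∈ T3 n,
      headLen T t.1 (a : ℕ) y * hb0Len T t.2.1 (a : ℕ) (b : ℕ) y * tailLen T t.2.2 (b : ℕ) y))
      (2 * (dN y + ∑ a : Fin (2 * T), ∑ b : Fin (2 * T), ∑ t ∈ T3 n,
        ((dF t.1 (a : ℕ) y * hb0Len T t.2.1 (a : ℕ) (b : ℕ) y + headLen T t.1 (a : ℕ) y * dD t.2.1 (a : ℕ) (b : ℕ) y) *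
            tailLen T t.2.2 (b : ℕ) y +
          headLen T t.1 (a : ℕ) y * hb0Len T t.2.1 (a : ℕ) (b : ℕ) y * dG t.2.2 (b : ℕ) y))) y :=
    (hN_deriv.add hsum3).const_mul 2
  have hEq : (fun y => 2 * (noRenLen T n y + ∑ a : Fin (2 * T), ∑ b : Fin (2 * T), ∑ t ∈ T3 n,
      headLen T t.1 (a : ℕ) y * hb0Len T t.2.1 (a : ℕ) (b : ℕ) y * tailLen T t.2.2 (b : ℕ) y)) =ᶠ[𝓝 y] (fun y => betaLenSum T n y) := by
    filter_upwards [Ioi_mem_nhds hy] with y' hy'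
    rw [betaLenSum_eq_two_mul hT (le_of_lt hy') n, betaRenewalLen]
  have huniq := hLHS.unique (hRHS.congr_of_eventuallyEq hEq.symm)
  -- multiply by `y`
  have eB : y * dB y = betaCon T n y := mul_derivVertexSum_eq _ y
  have eN : y * dN y = noRenCon T n y := mul_derivVertexSum_eq _ y
  have eF : ∀ i (c : ℤ), y * dF i c y = headCon T i c y := fun i c => mul_derivVertexSum_eq _ y
  have eD : ∀ j (c e : ℤ), y * dD j c e y = hb0Con T j c e y := fun j c e => mul_derivSum_eq_contactSum _ y
  have eG : ∀ k (e : ℤ), y * dG k e y = tailCon T k e y := fun k e => mul_derivSum_eq_contactSum _ y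
  rw [← eB, huniq, ← eN]
  simp only [← eF, ← eD, ← eG]
  rw [mul_left_comm]
  congr 1
  rw [mul_add]
  congr 1
  rw [Finset.mul_sum]
  refine sum_congr rfl fun a _ => ?_
  rw [Finset.mul_sum]
  refine sum_congr rfl fun b _ => ?_
  rw [Finset.mul_sum]
  refine sum_congr rfl fun t _ => ?_
  ring

end Split

/-! ### §4 Bounds: a piece with `n` vertices has at most `n` contacts -/

section Bounds

variable {y : ℝ}

/-- `0 ≤ cfℓ_c(i) ≤ i · fℓ_c(i)`, `0 ≤ cdℓ_{ce}(j) ≤ j · dℓ_{ce}(j)`, `0 ≤ cgℓ_e(k) ≤ k · gℓ_e(k)`, `0 ≤ cnℓ(n) ≤ n · nℓ(n)` for `y ≥ 0` (plumbing).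
[cite: BeatonBousquetMelouDeGierDuminilCopinGuttmann2014, §3.2; lane plumbing a-p2 g24] -/
theorem con_le (hy : 0 ≤ y) (i j k n : ℕ) (c e : ℤ) :
    (0 ≤ headCon T i c y ∧ headCon T i c y ≤ i * headLen T i c y) ∧
      (0 ≤ hb0Con T j c e y ∧ hb0Con T j c e y ≤ j * hb0Len T j c e y) ∧
      (0 ≤ tailCon T k e y ∧ tailCon T k e y ≤ k * tailLen T k e y) ∧
      (0 ≤ noRenCon T n y ∧ noRenCon T n y ≤ n * noRenLen T n y) := by
  have hx := hexCriticalFugacity_pos_lt_one.1.le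
  have hw0 : ∀ l : List HV, 0 ≤ hexCriticalFugacity ^ l.length * y ^ topCnt T l := fun l => mul_nonneg (pow_nonneg hx _) (pow_nonneg hy _)
  refine ⟨⟨sum_nonneg fun l _ => mul_nonneg (Nat.cast_nonneg _) (hw0 l), ?_⟩,
    ⟨sum_nonneg fun l _ => mul_nonneg (Nat.cast_nonneg _) (wD_nonneg T hy _), ?_⟩,
    ⟨sum_nonneg fun l _ => mul_nonneg (Nat.cast_nonneg _) (wD_nonneg T hy _), ?_⟩,
    ⟨sum_nonneg fun l _ => mul_nonneg (Nat.cast_nonneg _) (hw0 l), ?_⟩⟩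
  · rw [headCon, headLen, headLenN, mul_sum]
    refine sum_le_sum fun l hl => mul_le_mul_of_nonneg_right ?_ (hw0 l)
    rw [mem_filter] at hl
    exact_mod_cast (topCnt_le_length T l).trans hl.2.le
  · rw [hb0Con, hb0Len, hb0LenN, mul_sum]
    refine sum_le_sum fun l hl => mul_le_mul_of_nonneg_right ?_ (wD_nonneg T hy _)
    rw [mem_filter] at hl
    have h := topCnt_le_length T l.tail
    rw [List.length_tail] at h
    exact_mod_cast (show topCnt T l.tail ≤ j by omega)
  · rw [tailCon, tailLen, tailLenN, mul_sum]
    refine sum_le_sum fun l hl => mul_le_mul_of_nonneg_right ?_ (wD_nonneg T hy _)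
    rw [mem_filter] at hl
    have h := topCnt_le_length T l.tail
    rw [List.length_tail] at h
    exact_mod_cast (show topCnt T l.tail ≤ k by omega)
  · rw [noRenCon, noRenLen, mul_sum]
    refine sum_le_sum fun l hl => mul_le_mul_of_nonneg_right ?_ (hw0 l)
    rw [mem_filter] at hl
    exact_mod_cast (topCnt_le_length T l).trans hl.2.le

/-- For `j ≥ 1` the contact-weighted middle slice is the contact slice of the bridge files: `cdℓ_{ce}(j) = Σ_{LUset T j j c e} #top·wD` (plumbing, as
`hb0Len_eq_LUs`). [cite: DuminilCopinHammond2013, §2.2; lane plumbing a-p2 g24] -/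
theorem hb0Con_eq_sum_LUset {j : ℕ} (hj : 1 ≤ j) (c e : ℤ) (y : ℝ) :
    hb0Con T j c e y = ∑ l ∈ LUset T j (j : ℤ) c e, (topCnt T l.tail : ℝ) * wD T y l := by
  rw [hb0Con]
  refine sum_congr ?_ fun _ _ => rfl
  ext b
  simp only [HB0, LUset, HBab, mem_filter, hlen]
  constructor
  · rintro ⟨⟨hB, hd, hl⟩, hlen⟩
    exact ⟨⟨hB, by omega, hd, hl⟩, by rw [hlen]; push_cast; ring⟩
  · rintro ⟨⟨hB, -, hd, hl⟩, hlen⟩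
    exact ⟨⟨hB, hd, hl⟩, by have := hlen; omega⟩

end Bounds

/-! ### §5 The three Tannery sums along even lengths -/

section Tannery

variable {u ℓ : Fin (2 * T) → ℝ} {ρ θ : ℝ}

/-- The head-contact and tail-contact terms are `o(n)`: `(1/(2m)) Σ_{i+j+k=2m} cfℓ_a(i) dℓ_{ab}(j) gℓ_b(k) → 0` and the same with the contacts on the
tail — Tannery with the zero limit (`cfℓ_a(i) ≤ i·fℓ_a(i)`, `i ≤ 2m`). [cite: Feller1968, XIII.3 (renewal with a delay: the end pieces have finite mass); DuminilCopinHammond2013, §2.2; lane «pcv-sawmu» a-p2 g24 — own] -/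
theorem tendsto_endContactTerms_div (hT : 2 ≤ T) (a b : Fin (2 * T)) :
    Tendsto (fun m : ℕ => (∑ t ∈ T3 (2 * m), headCon T t.1 (a : ℕ) (stripYT T) * hb0Len T t.2.1 (a : ℕ) (b : ℕ) (stripYT T) *
        tailLen T t.2.2 (b : ℕ) (stripYT T)) / (2 * (m : ℝ))) atTop (𝓝 0) ∧
      Tendsto (fun m : ℕ => (∑ t ∈ T3 (2 * m), headLen T t.1 (a : ℕ) (stripYT T) * hb0Len T t.2.1 (a : ℕ) (b : ℕ) (stripYT T) *
        tailCon T t.2.2 (b : ℕ) (stripYT T)) / (2 * (m : ℝ))) atTop (𝓝 0) := by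
  have hT1 : 1 ≤ T := by omega
  have hy : 0 ≤ stripYT T := (stripYT_pos hT1).le
  obtain ⟨K, hK⟩ := exists_hb0Len_stripYT_le hT1
  have hK0 : 0 ≤ K := le_trans (pieceLen_nonneg hy 0 ((a : ℕ) : ℤ) ((b : ℕ) : ℤ)).2.1 (hK 0 a b)
  have hsF := summable_headLen hT ((a : ℕ) : ℤ)
  have hsG := summable_tailLen hT ((b : ℕ) : ℤ)
  have hF0 : ∀ i, 0 ≤ headLen T i (a : ℕ) (stripYT T) := fun i => (pieceLen_nonneg hy i ((a : ℕ) : ℤ) ((b : ℕ) : ℤ)).1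
  have hG0 : ∀ k, 0 ≤ tailLen T k (b : ℕ) (stripYT T) := fun k => (pieceLen_nonneg hy k ((a : ℕ) : ℤ) ((b : ℕ) : ℤ)).2.2
  have hD0 : ∀ j, 0 ≤ hb0Len T j (a : ℕ) (b : ℕ) (stripYT T) := fun j => (pieceLen_nonneg hy j ((a : ℕ) : ℤ) ((b : ℕ) : ℤ)).2.1
  have hbound : Summable (fun p : ℕ × ℕ => headLen T p.1 (a : ℕ) (stripYT T) * K * tailLen T p.2 (b : ℕ) (stripYT T)) :=
    Summable.mul_of_nonneg (f := fun i => headLen T i (a : ℕ) (stripYT T) * K) (g := fun k => tailLen T k (b : ℕ) (stripYT T))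
      (hsF.mul_right K) hsG (fun i => mul_nonneg (hF0 i) hK0) hG0
  -- rewriting a `T3` sum as a `tsum` over `ℕ × ℕ`
  have hT3 : ∀ (m : ℕ) (F : ℕ → ℕ → ℕ → ℝ),
      (∑ t ∈ T3 (2 * m), F t.1 t.2.1 t.2.2) = ∑' p : ℕ × ℕ, (if p.1 + p.2 ≤ 2 * m then F p.1 (2 * m - p.1 - p.2) p.2 else 0) := by
    intro m F
    classical
    have hinj : Set.InjOn (fun t : ℕ × ℕ × ℕ => (t.1, t.2.2)) (T3 (2 * m) : Set (ℕ × ℕ × ℕ)) := by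
      intro t ht t' ht' h
      rw [mem_coe, mem_T3] at ht ht'
      simp only [Prod.mk.injEq] at h
      refine Prod.ext h.1 (Prod.ext ?_ h.2)
      omega
    rw [tsum_eq_sum (s := (T3 (2 * m)).image fun t => (t.1, t.2.2)) (fun p hp => ?_)]
    · rw [sum_image hinj]
      refine sum_congr rfl fun t ht => ?_
      rw [mem_T3] at ht
      rw [if_pos (by simp only; omega)]
      have hj : 2 * m - t.1 - t.2.2 = t.2.1 := by omega
      simp only [hj]
    · rw [if_neg]
      intro hle
      apply hp
      rw [mem_image]
      exact ⟨(p.1, 2 * m - p.1 - p.2, p.2), mem_T3.2 (by simp only; omega), rfl⟩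
  constructor
  · -- head contacts
    set Φ : ℕ → ℕ × ℕ → ℝ := fun m p => (if p.1 + p.2 ≤ 2 * m then
      headCon T p.1 (a : ℕ) (stripYT T) * hb0Len T (2 * m - p.1 - p.2) (a : ℕ) (b : ℕ) (stripYT T) * tailLen T p.2 (b : ℕ) (stripYT T)
      else 0) / (2 * (m : ℝ)) with hΦ
    have hpt : ∀ p : ℕ × ℕ, Tendsto (fun m => Φ m p) atTop (𝓝 0) := by
      intro p
      -- `|Φ_m(p)| ≤ C_p/(2m)`
      have hC : ∀ m, |Φ m p| ≤ headCon T p.1 (a : ℕ) (stripYT T) * K * tailLen T p.2 (b : ℕ) (stripYT T) * (1 / (2 * (m : ℝ))) := by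
        intro m
        rw [hΦ]
        simp only
        have hc0 := (con_le (T := T) hy p.1 0 0 0 ((a : ℕ) : ℤ) ((b : ℕ) : ℤ)).1.1
        split_ifs with h
        · rw [abs_div, abs_of_nonneg (mul_nonneg (mul_nonneg hc0 (hD0 _)) (hG0 _)), abs_of_nonneg (by positivity : (0 : ℝ) ≤ 2 * (m : ℝ)),
            div_eq_mul_one_div]
          refine mul_le_mul_of_nonneg_right ?_ (by positivity)
          exact mul_le_mul_of_nonneg_right (mul_le_mul_of_nonneg_left (hK _ a b) hc0) (hG0 _)
        · rw [zero_div, abs_zero]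
          exact mul_nonneg (mul_nonneg (mul_nonneg hc0 hK0) (hG0 _)) (by positivity)
      have hlim : Tendsto (fun m : ℕ => headCon T p.1 (a : ℕ) (stripYT T) * K * tailLen T p.2 (b : ℕ) (stripYT T) * (1 / (2 * (m : ℝ))))
          atTop (𝓝 (headCon T p.1 (a : ℕ) (stripYT T) * K * tailLen T p.2 (b : ℕ) (stripYT T) * 0)) :=
        tendsto_const_nhds.mul (tendsto_const_nhds.div_atTop (Tendsto.const_mul_atTop two_pos tendsto_natCast_atTop_atTop))
      rw [mul_zero] at hlim
      exact squeeze_zero_norm (fun m => by rw [Real.norm_eq_abs]; exact hC m) hlim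
    have hdom : ∀ᶠ m in atTop, ∀ p : ℕ × ℕ, ‖Φ m p‖ ≤ headLen T p.1 (a : ℕ) (stripYT T) * K * tailLen T p.2 (b : ℕ) (stripYT T) := by
      filter_upwards [eventually_ge_atTop 1] with m hm p
      rw [Real.norm_eq_abs, hΦ]
      simp only
      have hc := (con_le (T := T) hy p.1 0 0 0 ((a : ℕ) : ℤ) ((b : ℕ) : ℤ)).1
      split_ifs with h
      · rw [abs_div, abs_of_nonneg (mul_nonneg (mul_nonneg hc.1 (hD0 _)) (hG0 _)), abs_of_nonneg (by positivity : (0 : ℝ) ≤ 2 * (m : ℝ)),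
          div_le_iff₀ (by positivity : (0 : ℝ) < 2 * (m : ℝ))]
        have hi : (p.1 : ℝ) ≤ 2 * (m : ℝ) := by exact_mod_cast (show p.1 ≤ 2 * m by omega)
        calc headCon T p.1 (a : ℕ) (stripYT T) * hb0Len T (2 * m - p.1 - p.2) (a : ℕ) (b : ℕ) (stripYT T) * tailLen T p.2 (b : ℕ) (stripYT T)
            ≤ ((p.1 : ℝ) * headLen T p.1 (a : ℕ) (stripYT T)) * K * tailLen T p.2 (b : ℕ) (stripYT T) :=
              mul_le_mul (mul_le_mul hc.2 (hK _ a b) (hD0 _) (mul_nonneg (Nat.cast_nonneg _) (hF0 _))) le_rfl (hG0 _)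
                (mul_nonneg (mul_nonneg (Nat.cast_nonneg _) (hF0 _)) hK0)
          _ ≤ headLen T p.1 (a : ℕ) (stripYT T) * K * tailLen T p.2 (b : ℕ) (stripYT T) * (2 * (m : ℝ)) := by
              have h1 : 0 ≤ headLen T p.1 (a : ℕ) (stripYT T) * K * tailLen T p.2 (b : ℕ) (stripYT T) :=
                mul_nonneg (mul_nonneg (hF0 _) hK0) (hG0 _)
              nlinarith
      · rw [zero_div, abs_zero]; exact mul_nonneg (mul_nonneg (hF0 _) hK0) (hG0 _)
    have hlim := tendsto_tsum_of_dominated_convergence (𝓕 := atTop) (f := Φ) (g := fun _ => (0 : ℝ))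
      (bound := fun p : ℕ × ℕ => headLen T p.1 (a : ℕ) (stripYT T) * K * tailLen T p.2 (b : ℕ) (stripYT T)) hbound hpt hdom
    rw [tsum_zero] at hlim
    refine hlim.congr fun m => ?_
    rw [hT3 m (fun i j k => headCon T i (a : ℕ) (stripYT T) * hb0Len T j (a : ℕ) (b : ℕ) (stripYT T) * tailLen T k (b : ℕ) (stripYT T)),
      hΦ, ← tsum_div_const]
  · -- tail contacts (same argument with `cgℓ_b(k) ≤ k·gℓ_b(k)`, `k ≤ 2m`)
    set Φ : ℕ → ℕ × ℕ → ℝ := fun m p => (if p.1 + p.2 ≤ 2 * m then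
      headLen T p.1 (a : ℕ) (stripYT T) * hb0Len T (2 * m - p.1 - p.2) (a : ℕ) (b : ℕ) (stripYT T) * tailCon T p.2 (b : ℕ) (stripYT T)
      else 0) / (2 * (m : ℝ)) with hΦ
    have hpt : ∀ p : ℕ × ℕ, Tendsto (fun m => Φ m p) atTop (𝓝 0) := by
      intro p
      have hC : ∀ m, |Φ m p| ≤ headLen T p.1 (a : ℕ) (stripYT T) * K * tailCon T p.2 (b : ℕ) (stripYT T) * (1 / (2 * (m : ℝ))) := by
        intro m
        rw [hΦ]
        simp only
        have hc0 := (con_le (T := T) hy 0 0 p.2 0 ((a : ℕ) : ℤ) ((b : ℕ) : ℤ)).2.2.1.1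
        split_ifs with h
        · rw [abs_div, abs_of_nonneg (mul_nonneg (mul_nonneg (hF0 _) (hD0 _)) hc0), abs_of_nonneg (by positivity : (0 : ℝ) ≤ 2 * (m : ℝ)),
            div_eq_mul_one_div]
          refine mul_le_mul_of_nonneg_right ?_ (by positivity)
          exact mul_le_mul_of_nonneg_right (mul_le_mul_of_nonneg_left (hK _ a b) (hF0 _)) hc0
        · rw [zero_div, abs_zero]
          exact mul_nonneg (mul_nonneg (mul_nonneg (hF0 _) hK0) hc0) (by positivity)
      have hlim : Tendsto (fun m : ℕ => headLen T p.1 (a : ℕ) (stripYT T) * K * tailCon T p.2 (b : ℕ) (stripYT T) * (1 / (2 * (m : ℝ))))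
          atTop (𝓝 (headLen T p.1 (a : ℕ) (stripYT T) * K * tailCon T p.2 (b : ℕ) (stripYT T) * 0)) :=
        tendsto_const_nhds.mul (tendsto_const_nhds.div_atTop (Tendsto.const_mul_atTop two_pos tendsto_natCast_atTop_atTop))
      rw [mul_zero] at hlim
      exact squeeze_zero_norm (fun m => by rw [Real.norm_eq_abs]; exact hC m) hlim
    have hdom : ∀ᶠ m in atTop, ∀ p : ℕ × ℕ, ‖Φ m p‖ ≤ headLen T p.1 (a : ℕ) (stripYT T) * K * tailLen T p.2 (b : ℕ) (stripYT T) := by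
      filter_upwards [eventually_ge_atTop 1] with m hm p
      rw [Real.norm_eq_abs, hΦ]
      simp only
      have hc := (con_le (T := T) hy 0 0 p.2 0 ((a : ℕ) : ℤ) ((b : ℕ) : ℤ)).2.2.1
      split_ifs with h
      · rw [abs_div, abs_of_nonneg (mul_nonneg (mul_nonneg (hF0 _) (hD0 _)) hc.1), abs_of_nonneg (by positivity : (0 : ℝ) ≤ 2 * (m : ℝ)),
          div_le_iff₀ (by positivity : (0 : ℝ) < 2 * (m : ℝ))]
        have hk : (p.2 : ℝ) ≤ 2 * (m : ℝ) := by exact_mod_cast (show p.2 ≤ 2 * m by omega)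
        calc headLen T p.1 (a : ℕ) (stripYT T) * hb0Len T (2 * m - p.1 - p.2) (a : ℕ) (b : ℕ) (stripYT T) * tailCon T p.2 (b : ℕ) (stripYT T)
            ≤ headLen T p.1 (a : ℕ) (stripYT T) * K * ((p.2 : ℝ) * tailLen T p.2 (b : ℕ) (stripYT T)) :=
              mul_le_mul (mul_le_mul_of_nonneg_left (hK _ a b) (hF0 _)) hc.2 hc.1 (mul_nonneg (hF0 _) hK0)
          _ ≤ headLen T p.1 (a : ℕ) (stripYT T) * K * tailLen T p.2 (b : ℕ) (stripYT T) * (2 * (m : ℝ)) := by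
              have h1 : 0 ≤ headLen T p.1 (a : ℕ) (stripYT T) * K * tailLen T p.2 (b : ℕ) (stripYT T) :=
                mul_nonneg (mul_nonneg (hF0 _) hK0) (hG0 _)
              nlinarith
      · rw [zero_div, abs_zero]; exact mul_nonneg (mul_nonneg (hF0 _) hK0) (hG0 _)
    have hlim := tendsto_tsum_of_dominated_convergence (𝓕 := atTop) (f := Φ) (g := fun _ => (0 : ℝ))
      (bound := fun p : ℕ × ℕ => headLen T p.1 (a : ℕ) (stripYT T) * K * tailLen T p.2 (b : ℕ) (stripYT T)) hbound hpt hdom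
    rw [tsum_zero] at hlim
    refine hlim.congr fun m => ?_
    rw [hT3 m (fun i j k => headLen T i (a : ℕ) (stripYT T) * hb0Len T j (a : ℕ) (b : ℕ) (stripYT T) * tailCon T k (b : ℕ) (stripYT T)),
      hΦ, ← tsum_div_const]

/-- ★ **Pointwise limit of the middle contact term along even lengths**: for fixed head length `i` and tail length `k`,
`fℓ_a(i) · cdℓ_{ab}(2m − i − k) · gℓ_b(k) / (2m) ⟶ fℓ_a(i) · θ_T · (2u_aℓ_b/⟨ℓ,M̄_len u⟩) · gℓ_b(k)` — the parities of `i` and `k` force the middle length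
onto the class `n_{k'} = 2k' + χ_a − χ_b` (`k' = m − c₀`), on which `Ĉ_D(k')/(n_{k'} D̂(k')) → θ_T` (#687) and `D̂(k') → 2u_aℓ_b/⟨ℓ,M̄_len u⟩` (#633), and
`n_{k'}/(2m) → 1`. [cite: Feller1968, XIII.3 (periodic renewal sequences); DuminilCopinHammond2013, §2.2; lane «pcv-sawmu» a-p2 g24 — own] -/
theorem tendsto_midContactTerm_even (hT : 2 ≤ T) (hu0 : ∀ a, 0 < u a) (hℓ0 : ∀ b, 0 < ℓ b)
    (hu : Iinf T (stripYT T) *ᵥ u = u) (hℓ : ℓ ᵥ* Iinf T (stripYT T) = ℓ) (a b : Fin (2 * T)) (p : ℕ × ℕ) :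
    Tendsto (fun m : ℕ => (if p.1 + p.2 ≤ 2 * m then
        headLen T p.1 (a : ℕ) (stripYT T) * hb0Con T (2 * m - p.1 - p.2) (a : ℕ) (b : ℕ) (stripYT T) * tailLen T p.2 (b : ℕ) (stripYT T)
        else 0) / (2 * (m : ℝ))) atTop
      (𝓝 (headLen T p.1 (a : ℕ) (stripYT T) *
        (((ℓ ⬝ᵥ ((Matrix.of fun c d : Fin (2 * T) =>
            ∑' n : ℕ, ∑ l ∈ LMset T n (n : ℤ) (c : ℕ) (d : ℕ), (topCnt T l.tail : ℝ) * wD T (stripYT T) l) *ᵥ u)) /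
          (ℓ ⬝ᵥ ((Matrix.of fun a b : Fin (2 * T) => ∑' n : ℕ, (n : ℝ) * LMM T n (n : ℤ) (stripYT T) a b) *ᵥ u))) *
          (2 * (u a * ℓ b / (ℓ ⬝ᵥ ((Matrix.of fun a b : Fin (2 * T) => ∑' n : ℕ, (n : ℝ) * LMM T n (n : ℤ) (stripYT T) a b) *ᵥ u))))) *
        tailLen T p.2 (b : ℕ) (stripYT T))) := by
  set θ : ℝ := (ℓ ⬝ᵥ ((Matrix.of fun c d : Fin (2 * T) =>
      ∑' n : ℕ, ∑ l ∈ LMset T n (n : ℤ) (c : ℕ) (d : ℕ), (topCnt T l.tail : ℝ) * wD T (stripYT T) l) *ᵥ u)) /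
    (ℓ ⬝ᵥ ((Matrix.of fun a b : Fin (2 * T) => ∑' n : ℕ, (n : ℝ) * LMM T n (n : ℤ) (stripYT T) a b) *ᵥ u)) with hθ
  set L2 : ℝ := 2 * (u a * ℓ b / (ℓ ⬝ᵥ ((Matrix.of fun a b : Fin (2 * T) => ∑' n : ℕ, (n : ℝ) * LMM T n (n : ℤ) (stripYT T) a b) *ᵥ u)))
    with hL2
  obtain ⟨i, k⟩ := p
  by_cases hFG : headLen T i (a : ℕ) (stripYT T) = 0 ∨ tailLen T k (b : ℕ) (stripYT T) = 0
  · have h0 : ∀ m : ℕ, (if i + k ≤ 2 * m then headLen T i (a : ℕ) (stripYT T) * hb0Con T (2 * m - i - k) (a : ℕ) (b : ℕ) (stripYT T) *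
        tailLen T k (b : ℕ) (stripYT T) else 0) / (2 * (m : ℝ)) = 0 := fun m => by
      split_ifs
      · rcases hFG with h | h <;> simp only [h, zero_mul, mul_zero, zero_div]
      · rw [zero_div]
    have hlim : headLen T i (a : ℕ) (stripYT T) * (θ * L2) * tailLen T k (b : ℕ) (stripYT T) = 0 := by
      rcases hFG with h | h <;> simp only [h, zero_mul, mul_zero]
    rw [hlim]
    simp only [h0]
    exact tendsto_const_nhds
  · obtain ⟨hF0, hG0⟩ := not_or.1 hFG
    have hpi := even_of_headLen_ne_zero hF0
    have hpk := even_of_tailLen_ne_zero hG0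
    obtain ⟨ha, hae⟩ := lchi_facts a
    obtain ⟨hb, hbe⟩ := lchi_facts b
    obtain ⟨r1, h1⟩ := hpi
    obtain ⟨r2, h2⟩ := hpk
    obtain ⟨r3, h3⟩ := hae
    obtain ⟨r4, h4⟩ := hbe
    obtain ⟨r, hr, hr0⟩ : ∃ r : ℤ, (i : ℤ) + k + lchi a - lchi b = 2 * r ∧ 0 ≤ r :=
      ⟨((a : ℕ) : ℤ) - ((b : ℕ) : ℤ) + (T : ℤ) - r1 - r2 - r3 + r4, by omega,
        by rcases ha with ha | ha <;> rcases hb with hb | hb <;> omega⟩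
    set c₀ : ℕ := r.toNat with hc₀
    have hc₀r : (c₀ : ℤ) = r := Int.toNat_of_nonneg hr0
    -- the contact slice and the hat quantities at index `m − c₀`
    set CD : ℕ → ℝ := fun k' => ∑ l ∈ LUset T (2 * k' + 1) (hatLen k' a b) (a : ℕ) (b : ℕ), (topCnt T l.tail : ℝ) * wD T (stripYT T) l
      with hCD
    have hEq : ∀ᶠ m : ℕ in atTop, (if i + k ≤ 2 * m then headLen T i (a : ℕ) (stripYT T) * hb0Con T (2 * m - i - k) (a : ℕ) (b : ℕ) (stripYT T) *
        tailLen T k (b : ℕ) (stripYT T) else 0) / (2 * (m : ℝ)) =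
        headLen T i (a : ℕ) (stripYT T) *
          (CD (m - c₀) / ((hatLen (m - c₀) a b : ℝ) * hatD T (stripYT T) (m - c₀) a b) * hatD T (stripYT T) (m - c₀) a b *
            ((hatLen (m - c₀) a b : ℝ) / (2 * (m : ℝ)))) * tailLen T k (b : ℕ) (stripYT T) := by
      filter_upwards [eventually_ge_atTop (c₀ + 1)] with m hm
      have hj : 1 ≤ 2 * m - i - k := by rcases ha with ha | ha <;> rcases hb with hb | hb <;> omega
      rw [if_pos (by omega)]
      have hσ : hatLen (m - c₀) a b = ((2 * m - i - k : ℕ) : ℤ) := by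
        unfold hatLen
        rcases ha with ha | ha <;> rcases hb with hb | hb <;> omega
      have hto : (hatLen (m - c₀) a b).toNat = 2 * m - i - k := by rw [hσ]; rfl
      have hslice : hb0Con T (2 * m - i - k) (a : ℕ) (b : ℕ) (stripYT T) = CD (m - c₀) := by
        rw [hb0Con_eq_sum_LUset hj, hCD]
        simp only
        rw [(hat_contactSlices_eq (stripYT T) (m - c₀) a b).1, hto]
      have hn0 : (hatLen (m - c₀) a b : ℝ) ≠ 0 := by rw [hσ]; push_cast; exact_mod_cast (show (2 * m - i - k : ℕ) ≠ 0 by omega)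
      have hm0 : (2 * (m : ℝ)) ≠ 0 := by exact_mod_cast (show (2 * m : ℕ) ≠ 0 by omega)
      rw [hslice]
      by_cases hD : hatD T (stripYT T) (m - c₀) a b = 0
      · -- then the contact slice vanishes too
        have hC0 : CD (m - c₀) = 0 := by
          have hf := (hat_contactSlices_facts hT (m - c₀) a b).1
          rw [hD, mul_zero] at hf
          exact le_antisymm hf.2 hf.1
        rw [hC0, hD]
        simp
      · field_simp
    -- limits of the three factors
    have hlim1 : Tendsto (fun m : ℕ => CD (m - c₀) / ((hatLen (m - c₀) a b : ℝ) * hatD T (stripYT T) (m - c₀) a b)) atTop (𝓝 θ) :=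
      (tendsto_contacts_per_step_pointwise hT hu0 hℓ0 hu hℓ a b).comp (tendsto_sub_atTop_nat c₀)
    have hlim2 : Tendsto (fun m : ℕ => hatD T (stripYT T) (m - c₀) a b) atTop (𝓝 L2) :=
      ((bridge_amplitudes_explicit hT hu0 hℓ0 hu hℓ a b).2).comp (tendsto_sub_atTop_nat c₀)
    have hlim3 : Tendsto (fun m : ℕ => (hatLen (m - c₀) a b : ℝ) / (2 * (m : ℝ))) atTop (𝓝 1) := by
      have hform : ∀ᶠ m : ℕ in atTop, (hatLen (m - c₀) a b : ℝ) / (2 * (m : ℝ)) = 1 - ((i : ℝ) + k) / (2 * (m : ℝ)) := by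
        filter_upwards [eventually_ge_atTop (c₀ + 1)] with m hm
        have hσ : (hatLen (m - c₀) a b : ℝ) = 2 * (m : ℝ) - ((i : ℝ) + k) := by
          have : hatLen (m - c₀) a b = 2 * (m : ℤ) - (i + k) := by
            unfold hatLen; rcases ha with ha | ha <;> rcases hb with hb | hb <;> omega
          rw [this]; push_cast; ring
        have hm0 : (2 * (m : ℝ)) ≠ 0 := by exact_mod_cast (show (2 * m : ℕ) ≠ 0 by omega)
        rw [hσ, sub_div, div_self hm0]
      have hl : Tendsto (fun m : ℕ => 1 - ((i : ℝ) + k) / (2 * (m : ℝ))) atTop (𝓝 (1 - 0)) :=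
        tendsto_const_nhds.sub (tendsto_const_nhds.div_atTop (Tendsto.const_mul_atTop two_pos tendsto_natCast_atTop_atTop))
      rw [sub_zero] at hl
      exact hl.congr' (hform.mono fun m hm => hm.symm)
    have hprod := ((hlim1.mul hlim2).mul hlim3)
    rw [mul_one] at hprod
    have hfull := (hprod.const_mul (headLen T i (a : ℕ) (stripYT T))).mul_const (tailLen T k (b : ℕ) (stripYT T))
    refine hfull.congr' (hEq.mono fun m hm => ?_)
    beta_reduce
    exact hm.symm

set_option maxHeartbeats 400000 in -- Tannery with two heavy summability side conditions (as in «BETA-LENGTH-LAW»; LANE NOTICE #11)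
/-- ★★ **The middle contact term converges along even lengths**: `(1/(2m)) Σ_{i+j+k=2m} fℓ_a(i) cdℓ_{ab}(j) gℓ_b(k) → Fℓ_a · θ_T · (2u_aℓ_b/⟨ℓ,M̄_len u⟩) · Gℓ_b`
— Tannery over `(i,k) ∈ ℕ²`, dominated by `fℓ_a(i)·K·gℓ_b(k)` (`cdℓ(j) ≤ j·dℓ(j) ≤ 2m·K`). [cite: Feller1968, XIII.3; DuminilCopinHammond2013, §2.2; lane «pcv-sawmu» a-p2 g24 — own] -/
theorem tendsto_midContactSum_div (hT : 2 ≤ T) (hu0 : ∀ a, 0 < u a) (hℓ0 : ∀ b, 0 < ℓ b)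
    (hu : Iinf T (stripYT T) *ᵥ u = u) (hℓ : ℓ ᵥ* Iinf T (stripYT T) = ℓ) (a b : Fin (2 * T)) :
    Tendsto (fun m : ℕ => (∑ t ∈ T3 (2 * m), headLen T t.1 (a : ℕ) (stripYT T) * hb0Con T t.2.1 (a : ℕ) (b : ℕ) (stripYT T) *
        tailLen T t.2.2 (b : ℕ) (stripYT T)) / (2 * (m : ℝ))) atTop
      (𝓝 (headLenGF T (a : ℕ) *
        (((ℓ ⬝ᵥ ((Matrix.of fun c d : Fin (2 * T) =>
            ∑' n : ℕ, ∑ l ∈ LMset T n (n : ℤ) (c : ℕ) (d : ℕ), (topCnt T l.tail : ℝ) * wD T (stripYT T) l) *ᵥ u)) /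
          (ℓ ⬝ᵥ ((Matrix.of fun a b : Fin (2 * T) => ∑' n : ℕ, (n : ℝ) * LMM T n (n : ℤ) (stripYT T) a b) *ᵥ u))) *
          (2 * (u a * ℓ b / (ℓ ⬝ᵥ ((Matrix.of fun a b : Fin (2 * T) => ∑' n : ℕ, (n : ℝ) * LMM T n (n : ℤ) (stripYT T) a b) *ᵥ u))))) *
        tailLenGF T (b : ℕ))) := by
  set Lc : ℝ := ((ℓ ⬝ᵥ ((Matrix.of fun c d : Fin (2 * T) =>
      ∑' n : ℕ, ∑ l ∈ LMset T n (n : ℤ) (c : ℕ) (d : ℕ), (topCnt T l.tail : ℝ) * wD T (stripYT T) l) *ᵥ u)) /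
    (ℓ ⬝ᵥ ((Matrix.of fun a b : Fin (2 * T) => ∑' n : ℕ, (n : ℝ) * LMM T n (n : ℤ) (stripYT T) a b) *ᵥ u))) *
    (2 * (u a * ℓ b / (ℓ ⬝ᵥ ((Matrix.of fun a b : Fin (2 * T) => ∑' n : ℕ, (n : ℝ) * LMM T n (n : ℤ) (stripYT T) a b) *ᵥ u)))) with hLc
  have hT1 : 1 ≤ T := by omega
  have hy : 0 ≤ stripYT T := (stripYT_pos hT1).le
  obtain ⟨K, hK⟩ := exists_hb0Len_stripYT_le hT1
  have hK0 : 0 ≤ K := le_trans (pieceLen_nonneg hy 0 ((a : ℕ) : ℤ) ((b : ℕ) : ℤ)).2.1 (hK 0 a b)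
  have hsF := summable_headLen hT ((a : ℕ) : ℤ)
  have hsG := summable_tailLen hT ((b : ℕ) : ℤ)
  have hF0 : ∀ i, 0 ≤ headLen T i (a : ℕ) (stripYT T) := fun i => (pieceLen_nonneg hy i ((a : ℕ) : ℤ) ((b : ℕ) : ℤ)).1
  have hG0 : ∀ k, 0 ≤ tailLen T k (b : ℕ) (stripYT T) := fun k => (pieceLen_nonneg hy k ((a : ℕ) : ℤ) ((b : ℕ) : ℤ)).2.2
  have hD0 : ∀ j, 0 ≤ hb0Len T j (a : ℕ) (b : ℕ) (stripYT T) := fun j => (pieceLen_nonneg hy j ((a : ℕ) : ℤ) ((b : ℕ) : ℤ)).2.1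
  have hbound : Summable (fun p : ℕ × ℕ => headLen T p.1 (a : ℕ) (stripYT T) * K * tailLen T p.2 (b : ℕ) (stripYT T)) :=
    Summable.mul_of_nonneg (f := fun i => headLen T i (a : ℕ) (stripYT T) * K) (g := fun k => tailLen T k (b : ℕ) (stripYT T))
      (hsF.mul_right K) hsG (fun i => mul_nonneg (hF0 i) hK0) hG0
  have hbase : Summable (fun p : ℕ × ℕ => headLen T p.1 (a : ℕ) (stripYT T) * tailLen T p.2 (b : ℕ) (stripYT T)) :=
    Summable.mul_of_nonneg (f := fun i => headLen T i (a : ℕ) (stripYT T)) (g := fun k => tailLen T k (b : ℕ) (stripYT T)) hsF hsG hF0 hG0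
  have hprod : Summable (fun p : ℕ × ℕ => headLen T p.1 (a : ℕ) (stripYT T) * Lc * tailLen T p.2 (b : ℕ) (stripYT T)) := by
    have h := hbase.mul_left Lc
    refine h.congr fun p => ?_
    ring
  set Φ : ℕ → ℕ × ℕ → ℝ := fun m p => (if p.1 + p.2 ≤ 2 * m then
      headLen T p.1 (a : ℕ) (stripYT T) * hb0Con T (2 * m - p.1 - p.2) (a : ℕ) (b : ℕ) (stripYT T) * tailLen T p.2 (b : ℕ) (stripYT T)
      else 0) / (2 * (m : ℝ)) with hΦ
  have hdom : ∀ᶠ m in atTop, ∀ p : ℕ × ℕ, ‖Φ m p‖ ≤ headLen T p.1 (a : ℕ) (stripYT T) * K * tailLen T p.2 (b : ℕ) (stripYT T) := by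
    filter_upwards [eventually_ge_atTop 1] with m hm p
    rw [Real.norm_eq_abs, hΦ]
    simp only
    have hc := (con_le (T := T) hy 0 (2 * m - p.1 - p.2) 0 0 ((a : ℕ) : ℤ) ((b : ℕ) : ℤ)).2.1
    split_ifs with h
    · rw [abs_div, abs_of_nonneg (mul_nonneg (mul_nonneg (hF0 _) hc.1) (hG0 _)), abs_of_nonneg (by positivity : (0 : ℝ) ≤ 2 * (m : ℝ)),
        div_le_iff₀ (by positivity : (0 : ℝ) < 2 * (m : ℝ))]
      have hj : ((2 * m - p.1 - p.2 : ℕ) : ℝ) ≤ 2 * (m : ℝ) := by exact_mod_cast (show 2 * m - p.1 - p.2 ≤ 2 * m by omega)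
      calc headLen T p.1 (a : ℕ) (stripYT T) * hb0Con T (2 * m - p.1 - p.2) (a : ℕ) (b : ℕ) (stripYT T) * tailLen T p.2 (b : ℕ) (stripYT T)
          ≤ headLen T p.1 (a : ℕ) (stripYT T) * (((2 * m - p.1 - p.2 : ℕ) : ℝ) * K) * tailLen T p.2 (b : ℕ) (stripYT T) :=
            mul_le_mul_of_nonneg_right (mul_le_mul_of_nonneg_left (hc.2.trans (mul_le_mul_of_nonneg_left (hK _ a b) (Nat.cast_nonneg _)))
              (hF0 _)) (hG0 _)
        _ ≤ headLen T p.1 (a : ℕ) (stripYT T) * K * tailLen T p.2 (b : ℕ) (stripYT T) * (2 * (m : ℝ)) := by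
            have h1 : 0 ≤ headLen T p.1 (a : ℕ) (stripYT T) * K * tailLen T p.2 (b : ℕ) (stripYT T) :=
              mul_nonneg (mul_nonneg (hF0 _) hK0) (hG0 _)
            nlinarith
    · rw [zero_div, abs_zero]; exact mul_nonneg (mul_nonneg (hF0 _) hK0) (hG0 _)
  have hlim : Tendsto (fun m : ℕ => ∑' p : ℕ × ℕ, Φ m p) atTop
      (𝓝 (∑' p : ℕ × ℕ, headLen T p.1 (a : ℕ) (stripYT T) * Lc * tailLen T p.2 (b : ℕ) (stripYT T))) :=
    tendsto_tsum_of_dominated_convergence (𝓕 := atTop) (f := Φ)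
      (g := fun p : ℕ × ℕ => headLen T p.1 (a : ℕ) (stripYT T) * Lc * tailLen T p.2 (b : ℕ) (stripYT T))
      (bound := fun p : ℕ × ℕ => headLen T p.1 (a : ℕ) (stripYT T) * K * tailLen T p.2 (b : ℕ) (stripYT T))
      hbound (fun p => by have := tendsto_midContactTerm_even hT hu0 hℓ0 hu hℓ a b p; rwa [← hLc] at this) hdom
  have hg : ∑' p : ℕ × ℕ, headLen T p.1 (a : ℕ) (stripYT T) * Lc * tailLen T p.2 (b : ℕ) (stripYT T) =
      headLenGF T (a : ℕ) * Lc * tailLenGF T (b : ℕ) := by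
    rw [headLenGF, tailLenGF, ← tsum_mul_right]
    exact ((hsF.mul_right _).tsum_mul_tsum hsG hprod).symm
  rw [← hg]
  -- the finite `T3`-sum is the `tsum`
  have hT3 : ∀ m : ℕ, (∑ t ∈ T3 (2 * m), headLen T t.1 (a : ℕ) (stripYT T) * hb0Con T t.2.1 (a : ℕ) (b : ℕ) (stripYT T) *
      tailLen T t.2.2 (b : ℕ) (stripYT T)) / (2 * (m : ℝ)) = ∑' p : ℕ × ℕ, Φ m p := by
    intro m
    classical
    have hinj : Set.InjOn (fun t : ℕ × ℕ × ℕ => (t.1, t.2.2)) (T3 (2 * m) : Set (ℕ × ℕ × ℕ)) := by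
      intro t ht t' ht' h
      rw [mem_coe, mem_T3] at ht ht'
      simp only [Prod.mk.injEq] at h
      refine Prod.ext h.1 (Prod.ext ?_ h.2)
      omega
    rw [tsum_eq_sum (s := (T3 (2 * m)).image fun t => (t.1, t.2.2)) (fun p hp => ?_)]
    · rw [sum_image hinj, Finset.sum_div]
      refine sum_congr rfl fun t ht => ?_
      rw [mem_T3] at ht
      rw [hΦ]
      simp only
      rw [if_pos (by omega)]
      have hj : 2 * m - t.1 - t.2.2 = t.2.1 := by omega
      simp only [hj]
    · rw [hΦ]
      simp only
      rw [if_neg, zero_div]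
      intro hle
      apply hp
      rw [mem_image]
      exact ⟨(p.1, 2 * m - p.1 - p.2, p.2), mem_T3.2 (by simp only; omega), rfl⟩
  exact hlim.congr fun m => (hT3 m).symm

end Tannery

/-! ### §6 ★★★★ The contact density of long critical β-walks -/

section Law

variable {u ℓ : Fin (2 * T) → ℝ}

/-- ★★★★ **THE SURFACE-CONTACT DENSITY OF LONG CRITICAL β-WALKS IS THE BRIDGE DENSITY `θ_T`** (`T ≥ 2`).  With
`cβ_T(n) = Σ_{β-walks ω of S_T with n vertices} #top(ω) · x_c^{n} y_T^{#top(ω)}` and `bℓ_T(n)` the same sum without `#top(ω)` («BETA-LENGTH-LAW»: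
`bℓ_T(2m) → Λℓ_T > 0`), for ANY positive fixed vectors `u`, `ℓ` of the critical kernel `Iinf T y_T`:
`cβ_T(2m) / (2m · bℓ_T(2m)) ⟶ θ_T = ⟨ℓ, C̄_M u⟩/⟨ℓ, M̄_len u⟩`
— the MEAN NUMBER OF SURFACE CONTACTS PER STEP of a critical β-walk with exactly `2m` vertices converges to the bridge density `θ_T` of #687: heads and
tails have finite mass at `y_T`, so they carry only `o(m)` contacts (no moment hypothesis on the head/tail pieces is needed — HANDOFF-gen23 item 1).
Ingredients: `y∂_y` of the exact length split (§3), Tannery over the head/tail lengths (§5), the pointwise bridge contact law and bridge length law on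
the forced parity class, `nℓ(2m) → 0`. [cite: Feller1968, XIII.3 (renewal with a delay), XIII.6; DuminilCopinHammond2013, §2.2; BeatonBousquetMelouDeGierDuminilCopinGuttmann2014, §3.2, Corollary 8 (B_T(x; y), y_T); lane «pcv-sawmu» a-p2 g24 — own result, not in print] -/
theorem tendsto_beta_contacts_per_step (hT : 2 ≤ T) (hu0 : ∀ a, 0 < u a) (hℓ0 : ∀ b, 0 < ℓ b)
    (hu : Iinf T (stripYT T) *ᵥ u = u) (hℓ : ℓ ᵥ* Iinf T (stripYT T) = ℓ) :
    Tendsto (fun m : ℕ => betaCon T (2 * m) (stripYT T) / ((2 * (m : ℝ)) * betaLenSum T (2 * m) (stripYT T))) atTop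
      (𝓝 ((ℓ ⬝ᵥ ((Matrix.of fun c d : Fin (2 * T) =>
          ∑' n : ℕ, ∑ l ∈ LMset T n (n : ℤ) (c : ℕ) (d : ℕ), (topCnt T l.tail : ℝ) * wD T (stripYT T) l) *ᵥ u)) /
        (ℓ ⬝ᵥ ((Matrix.of fun a b : Fin (2 * T) => ∑' n : ℕ, (n : ℝ) * LMM T n (n : ℤ) (stripYT T) a b) *ᵥ u)))) := by
  have hT1 : 1 ≤ T := by omega
  have hyT : 0 < stripYT T := stripYT_pos hT1
  set θ : ℝ := (ℓ ⬝ᵥ ((Matrix.of fun c d : Fin (2 * T) =>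
      ∑' n : ℕ, ∑ l ∈ LMset T n (n : ℤ) (c : ℕ) (d : ℕ), (topCnt T l.tail : ℝ) * wD T (stripYT T) l) *ᵥ u)) /
    (ℓ ⬝ᵥ ((Matrix.of fun a b : Fin (2 * T) => ∑' n : ℕ, (n : ℝ) * LMM T n (n : ℤ) (stripYT T) a b) *ᵥ u)) with hθ
  set dl : ℝ := ℓ ⬝ᵥ ((Matrix.of fun a b : Fin (2 * T) => ∑' n : ℕ, (n : ℝ) * LMM T n (n : ℤ) (stripYT T) a b) *ᵥ u) with hdl
  obtain ⟨hl, -⟩ := tendsto_stripLenD_residue_explicit hT hu0 hℓ0 hu hℓ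
  rw [← hdl] at hl
  -- the length law of the β-walks with the SAME data: `bℓ(2m) → Λ := 2·Σ_{a,b} Fℓ_a (2 u_aℓ_b/dl) Gℓ_b`
  have hlaw : ∀ a b : Fin (2 * T), Tendsto (fun k : ℕ => LUM T (2 * k + 1) (2 * (k : ℤ) + lchi a - lchi b) (stripYT T) a b) atTop
      (𝓝 (2 * ((1 / dl) * (u a * ℓ b)))) := fun a b => by
    have := (bridge_amplitudes_explicit hT hu0 hℓ0 hu hℓ a b).2
    rwa [← hdl, show u a * ℓ b / dl = 1 / dl * (u a * ℓ b) by ring] at this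
  set Λ : ℝ := 2 * (0 + ∑ a : Fin (2 * T), ∑ b : Fin (2 * T), headLenGF T (a : ℕ) * (2 * ((1 / dl) * (u a * ℓ b))) * tailLenGF T (b : ℕ))
    with hΛ
  have hB : Tendsto (fun m : ℕ => betaLenSum T (2 * m) (stripYT T)) atTop (𝓝 Λ) := by
    have h := ((tendsto_noRenLen_atTop hT).comp (tendsto_id.const_mul_atTop' two_pos)).add
      (tendsto_betaRenewalLen_even hT hu0 hℓ0 (one_div_pos.2 hl) hlaw)
    have h2 := h.const_mul 2
    refine h2.congr fun m => ?_
    rw [betaLenSum_eq_two_mul hT1 hyT.le]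
    rfl
  -- `Λ > 0` (it is the positive limit of «BETA-LENGTH-LAW»)
  have hΛpos : 0 < Λ := by
    obtain ⟨Λ', hΛ', hlim', -⟩ := exists_pos_tendsto_betaLenSum_even hT
    rwa [tendsto_nhds_unique hB hlim']
  -- the contact sum: `cβ(2m)/(2m) → 2·(0 + Σ_{a,b} (0 + Fℓ_a·θ·(2u_aℓ_b/dl)·Gℓ_b + 0)) = θ·Λ`
  have hC : Tendsto (fun m : ℕ => betaCon T (2 * m) (stripYT T) / (2 * (m : ℝ))) atTop (𝓝 (θ * Λ)) := by
    -- no-renewal part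
    have hN : Tendsto (fun m : ℕ => noRenCon T (2 * m) (stripYT T) / (2 * (m : ℝ))) atTop (𝓝 0) := by
      have hup := (tendsto_noRenLen_atTop hT).comp (tendsto_id.const_mul_atTop' two_pos)
      refine squeeze_zero' ?_ ?_ hup
      · filter_upwards with m
        exact div_nonneg (con_le hyT.le 0 0 0 (2 * m) 0 0).2.2.2.1 (by positivity)
      · filter_upwards [eventually_ge_atTop 1] with m hm
        have hm0 : (0 : ℝ) < 2 * (m : ℝ) := by exact_mod_cast (show 0 < 2 * m by omega)
        rw [div_le_iff₀ hm0]
        have := (con_le (T := T) hyT.le 0 0 0 (2 * m) 0 0).2.2.2.2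
        simp only [Function.comp, id]
        calc noRenCon T (2 * m) (stripYT T) ≤ ((2 * m : ℕ) : ℝ) * noRenLen T (2 * m) (stripYT T) := this
          _ = noRenLen T (2 * m) (stripYT T) * (2 * (m : ℝ)) := by push_cast; ring
    -- the three Tannery terms, level pair by level pair
    have hS : ∀ a b : Fin (2 * T), Tendsto (fun m : ℕ => (∑ t ∈ T3 (2 * m),
        (headCon T t.1 (a : ℕ) (stripYT T) * hb0Len T t.2.1 (a : ℕ) (b : ℕ) (stripYT T) * tailLen T t.2.2 (b : ℕ) (stripYT T) +
          headLen T t.1 (a : ℕ) (stripYT T) * hb0Con T t.2.1 (a : ℕ) (b : ℕ) (stripYT T) * tailLen T t.2.2 (b : ℕ) (stripYT T) +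
          headLen T t.1 (a : ℕ) (stripYT T) * hb0Len T t.2.1 (a : ℕ) (b : ℕ) (stripYT T) * tailCon T t.2.2 (b : ℕ) (stripYT T))) /
        (2 * (m : ℝ))) atTop
        (𝓝 (0 + headLenGF T (a : ℕ) * (θ * (2 * (u a * ℓ b / dl))) * tailLenGF T (b : ℕ) + 0)) := fun a b => by
      obtain ⟨h1, h3⟩ := tendsto_endContactTerms_div hT a b
      have h2 := tendsto_midContactSum_div hT hu0 hℓ0 hu hℓ a b
      rw [← hθ, ← hdl] at h2
      have h := (h1.add h2).add h3
      refine h.congr fun m => ?_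
      rw [← add_div, ← add_div, ← sum_add_distrib, ← sum_add_distrib]
    have hsum := tendsto_finsetSum (Finset.univ : Finset (Fin (2 * T))) fun a _ =>
      tendsto_finsetSum (Finset.univ : Finset (Fin (2 * T))) fun b _ => hS a b
    have htot := (hN.add hsum).const_mul 2
    have hval : 2 * (0 + ∑ a : Fin (2 * T), ∑ b : Fin (2 * T), (0 + headLenGF T (a : ℕ) * (θ * (2 * (u a * ℓ b / dl))) * tailLenGF T (b : ℕ) + 0)) =
        θ * Λ := by
      rw [hΛ, zero_add, zero_add, mul_sum, mul_sum, mul_sum]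
      refine sum_congr rfl fun a _ => ?_
      rw [mul_sum, mul_sum, mul_sum]
      refine sum_congr rfl fun b _ => ?_
      ring
    rw [hval] at htot
    refine htot.congr' ?_
    filter_upwards [eventually_ge_atTop 1] with m hm
    rw [betaCon_eq_two_mul hT1 hyT (2 * m), mul_div_assoc, add_div, Finset.sum_div]
    congr 2
    refine sum_congr rfl fun a _ => ?_
    rw [Finset.sum_div]
  -- the ratio
  have hq := hC.div hB hΛpos.ne'
  rw [mul_div_cancel_right₀ _ hΛpos.ne'] at hq
  refine hq.congr fun m => ?_
  simp only [Pi.div_apply]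
  rw [div_div]

/-- ★★★ **WIDTH TWO: the surface contacts per step of a long critical β-walk of `S₂` tend to `(3 − √2)/4` in mean** — unconditional, with the
closed-form Perron data of «WIDTH-TWO-KERNEL» (#715: `⟨ℓ, C̄_M u⟩ = 7`, `⟨ℓ, M̄_len u⟩ = 20 − 8x_c²`, `7·4 = (3 − √2)(20 − 8x_c²)`).
[cite: BeatonBousquetMelouDeGierDuminilCopinGuttmann2014, Corollary 8 (the strip at (x_c, y_T)); Feller1968, XIII.6; lane «pcv-sawmu» a-p2 g24 — own result] -/
theorem widthTwo_beta_contacts_per_step :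
    Tendsto (fun m : ℕ => betaCon 2 (2 * m) (stripYT 2) / ((2 * (m : ℝ)) * betaLenSum 2 (2 * m) (stripYT 2))) atTop
      (𝓝 ((3 - Real.sqrt 2) / 4)) := by
  have h := tendsto_beta_contacts_per_step (T := 2) le_rfl W2.uTwo_pos W2.ellTwo_pos W2.Iinf_two_fixed.1 W2.Iinf_two_fixed.2
  have hval : (W2.ellTwo ⬝ᵥ ((Matrix.of fun c d : Fin (2 * 2) =>
      ∑' n : ℕ, ∑ l ∈ LMset 2 n (n : ℤ) (c : ℕ) (d : ℕ), (topCnt 2 l.tail : ℝ) * wD 2 (stripYT 2) l) *ᵥ W2.uTwo)) /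
      (W2.ellTwo ⬝ᵥ ((Matrix.of fun a b : Fin (2 * 2) => ∑' n : ℕ, (n : ℝ) * LMM 2 n (n : ℤ) (stripYT 2) a b) *ᵥ W2.uTwo)) =
      (3 - Real.sqrt 2) / 4 := by
    rw [W2.contactMomentMatrix_two_eq, W2.lengthMomentMatrix_two_eq, W2.contact_scalar_two.1, W2.perron_scalars_two.2]
    have hpos : 0 < 20 - 8 * hexCriticalFugacity ^ 2 := by nlinarith [W2.xc_sq_bounds.2]
    have h4 := W2.contact_scalar_two.2
    rw [W2.contact_scalar_two.1, W2.perron_scalars_two.2] at h4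
    rw [div_eq_div_iff hpos.ne' (by norm_num : (4 : ℝ) ≠ 0)]
    linarith
  rw [hval] at h
  exact h

end Law

end HV

end Literature.Probability.RandomPlanarGeometry.SAW
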